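import Literature.Probability.FitznerVanDerHofstad2017.MeanFieldD11AppDDischarged
import HarnessLib

/-!
# Mean-field behaviour at `d = 11` on the kernel App.-D line, VIII: App. D discharged AND (S2a) at the typed Stage-1 record cells

CITATION HEADER (PLACEMENT v2). Part of the certified REPRODUCTION of R. Fitzner, R. van der Hofstad, *Mean-field behavior for
nearest-neighbor percolation in d > 10*, EJP 22 (2017) no. 43 [FvdH17] and *Generalized approach to the non-backtracking lace
expansion*, PTRF 169 (2017) 1041–1119 [NoBLE17]; build `lace`, seat lean2 (gen 13), module 14.  ADDITIVE: every record file
(`MeanFieldD11Cert` rev 6 = the certificate OF RECORD, `MeanFieldD11Inputs`, `NobleInstantiate`, `NobleAssumptions`, `BetaMap`, the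
`Stage1*` generated modules) and modules I–VII of this line are untouched; nothing here is a cited fact; no `def … : Prop`; `d = 11` only.

WHAT THIS MODULE DOES.  Module VII (`MeanFieldD11AppDDischarged`) proved `MeanField 11` from (S2a) Assumption 4.3 with the PUBLISHED
constants `inputsI` / `inputsO` and (S2b) Prop. 2.2, with NO App.-D hypothesis (`nobleSimplifiedFormAt_percolation₅` of module 3c-B composed
with the certificate `P(γ', Γ)` at the `β^corr` tables, module VI).  Module II (`MeanFieldD11AppDStage1`) moved the (S2a) hypotheses
from the published decimals to the constants COMPUTED IN THE KERNEL by the typed Stage-1 record cell with tails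
(`inpMajQ dataHi P stateRec .i/.o SQr SbQr`, certified SRW tables, state `(Γ₁, m, Γ₂, c)`), via the dominations `inpMajQrec_hi_dom_o`
(cell at `o` ≤ `inputsO`, 60/60 fields) and `inpMajQrec_hi_dom_i2` (cell at `i` ≤ the auxiliary record `inputsI2 = inputsI` with
`xiIotaOdd` enlarged by the factor `1 + 3/200000`).  This module does both at once:

  `meanField_full_d11_typedStage1_discharged : (S2a′ at p_I: Assumption 4.3 with the typed cell at i) → (S2b bi) →
     (∀ p ∈ (p_I, p_c), f(p) ≤ Γ → S2a′ with the typed cell at o ∧ S2b bo) → MeanField 11`,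

through `nobleSimplifiedFormAt_percolation₅` at `inputsI2` / `inputsO` ((N4) at `inputsI2` is (N4) at `inputsI`: `α̲_F` does not read
`xiIotaOdd`) and the certificate `P(γ', Γ)` at `(β^corr(inputsI2), β^corr(inputsO))` (`nobleCertificate_d11_corrI2`: the initial-point
admissibility and `f₂`-condition re-evaluated by `norm_num`, everything else from `nobleCertificate_d11_corr` / `nobleCertificate_d11_inputsI2`).

REMAINING HYPOTHESES (ANALYTIC, displayed binders, NOT CITABLE as typed; no named fact): (S2a′) [NoBLE17] Assumption 4.3 for the
percolation split with the constants of the TYPED STAGE-1 RECORD CELL WITH TAILS — at `p_I` (point `i`) and at every `p ∈ (p_I, p_c)` with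
`f(p) ≤ Γ` (point `o`); (S2b) [FvdH17] Prop. 2.2 (`bi`, `bo`).  Nothing of App. D, no published Stage-1 decimal.
SCOPE CAVEAT (REFEREE R288 (a)(iii) / W51.1): (S2a′) is stated at the Stage-1 cells AS CODED in `Percolation.nb` cells 1–44 (coded
repulsive-polygon multiplicities); the D57 / N72(b) derivable-multiplicity twins are NOT included here (their `d = 11` instantiation is
`MeanFieldD11Stage1TailsEvalU` / `MeanFieldD11AppDStage1U`); nothing here asserts that a coded cell bounds the lattice quantity it names —
that is the derivation's node (N35′, transport (T)).  EPISTEMIC STATUS: kernel App.-D line (β-map as wired, D29) at the D65 bookkeeping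
table `β^corr` with the free parameter `γ' = gammaD65` — NOT the certificate of record; sentences of record unchanged; no `d ≠ 11`.
FREE-PARAMETER CLAUSE (REFEREE2 ref2-R42/R43, REFEREE W54.2): on this line the record's free parameter `γ₂ = 1.108259` (`gammaC 1`) is
INFEASIBLE — `f2Bound (β^corr(inputsO)) > γ₂` is the kernel theorem `D11.f2BoundCorr_o_not_le_gammaC` (module `MeanFieldD11AppDCorr`) —
and `γ'₂ = 1.10845` (`gammaD65 1`, inside `[f2Bound(β^corr(inputsO)), Γ₂)`, `Γ₂ = 1.1084502`) is used instead; `γ₁`, `γ₃`, `Γ` are the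
record's.

REVISION 2 (lean2 gen 14): module docstring only (the free-parameter clause above); no declaration, statement or proof changed.

f₃-TABLE CLAUSE (REFEREE v56 R319 (e) = ORDERS v56 W56.2; REFEREE2 v48 ref2-R44 (b)): `bo` here is rev 6's β_Δ-WIRED f₃
table (`Percolation.nb` cell [144] passes `1/(α_F,low − β_Δ)` as the last argument of every `s = o` `BoundFThreeBound` cell, so the six
`bo` literals are functions of `β_Δ`, while `bi` is not); the corrected chain's `b_o` at this cell (O12g U(12,28)) exceeds `c001` on
engine B (finding C46-F3, ONE engine: `b_o,{0,0,1}/c001 = 1.000103` as coded, `1.000080` printed wiring, `> Γ₃ = 1`), so this is the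
KERNEL SHAPE of the D65 certificate, not its corrected numerics — closing requires Cert rev 7 (O12g U(13,28), fallback O12h-B; two
engines; C46 BLOCKING).  In particular NO sentence of this module says that `P(γ', Γ)` holds at `β^corr` with CORRECTED f₃ tables:
the kernel theorems below pair `β^corr(inputsO)` with the rev-6 `bo` literal, exactly as typed (valid as typed, R319 (e)).
REVISION 3 (lean2 gen 14, W56.2): module docstring only (the f₃-table clause); every declaration byte-identical to
revision 1 (p187751); revision 2 (p188362) added the free-parameter clause.

[cite: FitznerVanDerHofstad2017, Thm 1.1 / Cor. 1.3 (d = 11), Prop. 2.2, §2.4–§2.7, §§4–6 (Stage-1 diagrammatic estimates), §3.5]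
[cite: FitznerVanDerHofstad2016NoBLE, Thm 2.10, Prop. 2.11, Def. 2.9 (pp. 1060–1062); Prop. 4.5 (p. 1088); Assumption 4.3 (pp. 1086–1088); App. D (pp. 1110–1117)]
-/

noncomputable section

namespace Literature.Probability.FitznerVanDerHofstad2017

open _root_.MeasureTheory _root_.Filter _root_.Topology Literature.Probability.LatticeModels
open Literature.Barriers.CriticalPhenomena Literature.Probability.Percolation
open scoped BigOperators

namespace D11

open NoGoFrame Stage1Cells Stage1Cells.CertD11Rec
open Stage1Cells.CertD11 (P dataHi)
open Stage1Tails.Rec (inpMajQ)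

/-! ## 1. Side condition (N4) and the certificate at `(β^corr(inputsI2), β^corr(inputsO))` -/

/-- (N4) at `inputsI2` (`α̲_F` does not read `xiIotaOdd`; = `n4_inputsI`). [cite: FitznerVanDerHofstad2016NoBLE, App. D (D.5) p. 1110] -/
theorem n4_inputsI2 : 0 ≤ (BetaMap.nobleBetaOfInputs ((11 : ℕ) : ℝ) inputsI2).αFlow := by
  rw [beta_inputsI2_αFlow]; exact n4_inputsI

set_option maxHeartbeats 4000000 in
/-- `f2Bound(β^corr(inputsI2)) ≤ 1.064` (as at `inputsI`: margin `> 4·10⁻²`). [cite: FitznerVanDerHofstad2016NoBLE, Def. 2.9; Prop. 2.11 (f₂(z_I) ≤ γ₂)] -/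
theorem f2BoundCorr_i2_le : (BetaMap.nobleBetaOfInputsCorr 11 inputsI2).f2Bound 11 ≤ 1.064 := by
  norm_num [NobleBeta.f2Bound, inputsI2, inputsI, max_def, BetaMap.nobleBetaOfInputsCorr, BetaMap.betaRfDeltaCorr, BetaMap.nobleBetaOfInputs, BetaMap.betaMubarOverMu, BetaMap.betaCPhiUp, BetaMap.betaAfLow, BetaMap.betaapI, BetaMap.betaapII, BetaMap.betaPiHat, BetaMap.betaPsiHatLower, BetaMap.betaRp, BetaMap.betaRfDeltaLower]

set_option maxHeartbeats 4000000 in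
/-- **`P(γ', Γ)` at `d = 11` for the tables `β^corr(inputsI2)`, `β^corr(inputsO)`** (`γ' = gammaD65`): initial-point admissibility and
`f₂`-condition by `norm_num`; the `f₁`-field along `f1Bound_corr_eq` from `nobleCertificate_d11_inputsI2`; all window fields, `f₃`,
`c_μ`, `c`, `γ' < Γ` from `nobleCertificate_d11_corr`.  NOT the certificate of record.
[cite: FitznerVanDerHofstad2016NoBLE, Def. 2.9, Prop. 2.11, Assumption 2.7] [cite: FitznerVanDerHofstad2017, §2.5–§2.7 (d = 11)] -/
theorem nobleCertificate_d11_corrI2 :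
    NobleNumericCertificate 11 cMuC cWeightsC gammaD65 GammaC (BetaMap.nobleBetaOfInputsCorr 11 inputsI2)
      (BetaMap.nobleBetaOfInputsCorr 11 inputsO) bi bo where
  one_lt_cμ := nobleCertificate_d11_corr.one_lt_cμ
  c_pos := nobleCertificate_d11_corr.c_pos
  γ_lt_Γ := nobleCertificate_d11_corr.γ_lt_Γ
  admissible_init := by norm_num [NobleBeta.Admissible, inputsI2, inputsI, BetaMap.nobleBetaOfInputsCorr, BetaMap.betaRfDeltaCorr, BetaMap.nobleBetaOfInputs, BetaMap.betaMubarOverMu, BetaMap.betaCPhiUp, BetaMap.betaAfLow, BetaMap.betaapI, BetaMap.betaapII, BetaMap.betaPiHat, BetaMap.betaPsiHatLower, BetaMap.betaRp, BetaMap.betaRfDeltaLower]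
  admissible := nobleCertificate_d11_corr.admissible
  f1Bound_init_le := by rw [f1Bound_corr_eq, gammaD65_zero]; exact nobleCertificate_d11_inputsI2.f1Bound_init_le
  f2Bound_init_le := by rw [gammaD65_one]; norm_num [NobleBeta.f2Bound, inputsI2, inputsI, max_def, BetaMap.nobleBetaOfInputsCorr, BetaMap.betaRfDeltaCorr, BetaMap.nobleBetaOfInputs, BetaMap.betaMubarOverMu, BetaMap.betaCPhiUp, BetaMap.betaAfLow, BetaMap.betaapI, BetaMap.betaapII, BetaMap.betaPiHat, BetaMap.betaPsiHatLower, BetaMap.betaRp, BetaMap.betaRfDeltaLower]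
  f3_init_le := nobleCertificate_d11_corr.f3_init_le
  f1Bound_le := nobleCertificate_d11_corr.f1Bound_le
  f2Bound_le := nobleCertificate_d11_corr.f2Bound_le
  f3_le := nobleCertificate_d11_corr.f3_le

/-! ## 2. Prop. 4.5(ii) at `p_I` with `inputsI2`, App. D discharged -/

/-- [NoBLE17] Prop. 4.5(ii) at `p_I` with the auxiliary record `inputsI2`, App. D DISCHARGED (table `β^corr(inputsI2)`).
[cite: FitznerVanDerHofstad2016NoBLE, Prop. 4.5 (p. 1088); Assumption 4.3 (z = z_I); App. D] [cite: FitznerVanDerHofstad2017, §2.4–§2.5] -/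
theorem nobleSimplifiedFormAt_d11_i2₅
    (h43 : NobleAssumption43At 11 (nbwThresholdI 11)
      (percolationNobleSplit 11 (nbwThresholdI 11) two_le_eleven (nbwThresholdI_lt_criticalProbI two_le_eleven)) inputsI2) :
    NobleSimplifiedFormAt 11 (nbwThresholdI 11) (BetaMap.nobleBetaOfInputsCorr ((11 : ℕ) : ℝ) inputsI2) :=
  have hp := nbwThresholdI_lt_criticalProbI two_le_eleven
  have hp0 : 0 < ((nbwThresholdI 11 : unitInterval) : ℝ) := nbwThresholdI_pos (by norm_num)
  nobleSimplifiedFormAt_percolation₅ two_le_eleven hp hp0 inputsI2_WF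
    (percolationNobleEquationAt_of_summable two_le_eleven hp hp0 h43.xiAbs.2.1 fun ι => (h43.xiIotaAbs ι).2.1)
    h43 n1_inputsI2 n2_inputsI2 n3_inputsI2 n4_inputsI2

/-! ## 3. The two binders from (S2a′) at the typed cells + (S2b) -/

/-- **Initial-step binder at `d = 11` from (S2a′) at the typed Stage-1 record cell (point `i`, tails included) and (S2b) `bi`, App. D
discharged** (transport `cell ≤ inputsI2`: `nobleAssumption43At_inputsI2_of_stage1Full`). [cite: FitznerVanDerHofstad2016NoBLE, Prop. 4.5, Prop. 2.11; Assumption 4.3 (z = z_I)] [cite: FitznerVanDerHofstad2017, Prop. 2.2; §§4–6] -/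
theorem nobleInitialInputsAt_d11_typedStage1_discharged
    (hI43 : NobleAssumption43At 11 (nbwThresholdI 11)
      (percolationNobleSplit 11 (nbwThresholdI 11) two_le_eleven (nbwThresholdI_lt_criticalProbI two_le_eleven))
      (inpMajQ dataHi P stateRec .i SQr SbQr))
    (hIW : NobleWeightedDiagramBoundAt 11 (nbwThresholdI 11) bi) :
    NobleInitialInputsAt 11 (BetaMap.nobleBetaOfInputsCorr 11 inputsI2) bi := by
  have hS := nobleSimplifiedFormAt_d11_i2₅ (nobleAssumption43At_inputsI2_of_stage1Full hI43)
  simp only [Nat.cast_ofNat] at hS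
  exact ⟨hS, hIW⟩

/-- **Improvement-step binder at `d = 11` from (S2a′) at the typed Stage-1 record cell (point `o`, tails included) and (S2b) `bo` on the
window, App. D discharged** (transport `cell ≤ inputsO`: `nobleAssumption43At_inputsO_of_stage1Full`). [cite: FitznerVanDerHofstad2016NoBLE, Prop. 4.5, Prop. 2.11] [cite: FitznerVanDerHofstad2017, Prop. 2.2; §§4–6] -/
theorem nobleImprovementInputsAt_d11_typedStage1_discharged
    (hS : ∀ (p : unitInterval) (hp : p ∈ Set.Ioo (nbwThresholdI 11) (criticalProbI 11)),
      (∀ j, Literature.Barriers.CriticalPhenomena.nobleF 11 cMuC cWeightsC j p ≤ GammaC j) →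
        NobleAssumption43At 11 p (percolationNobleSplit 11 p two_le_eleven hp.2) (inpMajQ dataHi P stateRec .o SQr SbQr) ∧
        NobleWeightedDiagramBoundAt 11 p bo) :
    NobleImprovementInputsAt 11 cMuC cWeightsC GammaC (BetaMap.nobleBetaOfInputsCorr 11 inputsO) bo :=
  nobleImprovementInputsAt_d11_discharged fun p hp hΓ =>
    let ⟨h43, hW⟩ := hS p hp hΓ
    ⟨nobleAssumption43At_inputsO_of_stage1Full h43, hW⟩

/-! ## 4. The `d = 11` sentence: App. D discharged, (S2a′) at the typed cells -/

/-- **Mean-field behaviour at `d = 11` on the kernel App.-D line — App. D discharged, both Assumption-4.3 hypotheses at the typed Stage-1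
record cells (tails included, certified SRW tables).**  REMAINING HYPOTHESES (ANALYTIC, NOT CITABLE as typed; no named fact): (S2a′) at
`p_I` with the cell at `i`; (S2a′) on `(p_I, p_c)` under `f ≤ Γ` with the cell at `o`; (S2b) [FvdH17] Prop. 2.2's `bi`, `bo`.  SCOPE CAVEAT
(R288 (a)(iii)): cells AS CODED (coded repulsive-polygon multiplicities; D57 / N72(b) twins not included); nothing here asserts that a coded
cell bounds its lattice quantity.  Conclusion: triangle condition, `θ(p_c) = 0`, `β = 1` (bounded ratio) on `ℤ^11`.
[cite: FitznerVanDerHofstad2017, Thm 1.1 / Cor. 1.3 (d = 11: numerical verification re-run with certified arithmetic)]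
[cite: FitznerVanDerHofstad2016NoBLE, Thm 2.10, Prop. 2.11, Prop. 4.5, App. D] -/
theorem meanField_d11_typedStage1_discharged
    (hI43 : NobleAssumption43At 11 (nbwThresholdI 11)
      (percolationNobleSplit 11 (nbwThresholdI 11) two_le_eleven (nbwThresholdI_lt_criticalProbI two_le_eleven))
      (inpMajQ dataHi P stateRec .i SQr SbQr))
    (hIW : NobleWeightedDiagramBoundAt 11 (nbwThresholdI 11) bi)
    (hS : ∀ (p : unitInterval) (hp : p ∈ Set.Ioo (nbwThresholdI 11) (criticalProbI 11)),
      (∀ j, Literature.Barriers.CriticalPhenomena.nobleF 11 cMuC cWeightsC j p ≤ GammaC j) →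
        NobleAssumption43At 11 p (percolationNobleSplit 11 p two_le_eleven hp.2) (inpMajQ dataHi P stateRec .o SQr SbQr) ∧
        NobleWeightedDiagramBoundAt 11 p bo) :
    TriangleCondition 11 ∧ PercolationContinuity 11 ∧ BetaEqOneBoundedRatio 11 :=
  meanField_of_certificate (by norm_num) nobleCertificate_d11_corrI2 (nobleInitialInputsAt_d11_typedStage1_discharged hI43 hIW)
    (nobleImprovementInputsAt_d11_typedStage1_discharged hS)

/-- `θ(p_c) = 0` on `ℤ^11` (hypotheses as in `meanField_d11_typedStage1_discharged`). [cite: FitznerVanDerHofstad2017, Cor. 1.3 (d = 11)] -/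
theorem percolationContinuity_d11_typedStage1_discharged
    (hI43 : NobleAssumption43At 11 (nbwThresholdI 11)
      (percolationNobleSplit 11 (nbwThresholdI 11) two_le_eleven (nbwThresholdI_lt_criticalProbI two_le_eleven))
      (inpMajQ dataHi P stateRec .i SQr SbQr))
    (hIW : NobleWeightedDiagramBoundAt 11 (nbwThresholdI 11) bi)
    (hS : ∀ (p : unitInterval) (hp : p ∈ Set.Ioo (nbwThresholdI 11) (criticalProbI 11)),
      (∀ j, Literature.Barriers.CriticalPhenomena.nobleF 11 cMuC cWeightsC j p ≤ GammaC j) →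
        NobleAssumption43At 11 p (percolationNobleSplit 11 p two_le_eleven hp.2) (inpMajQ dataHi P stateRec .o SQr SbQr) ∧
        NobleWeightedDiagramBoundAt 11 p bo) :
    PercolationContinuity 11 :=
  (meanField_d11_typedStage1_discharged hI43 hIW hS).2.1

/-- **[FvdH17] Cor. 1.3 at `d = 11` in full (`MeanField 11`) — App. D discharged, (S2a′) at the typed Stage-1 record cells, (S2b)**
(hypotheses and SCOPE CAVEAT as in `meanField_d11_typedStage1_discharged`; exponents by `meanField_of_triangle`).
[cite: FitznerVanDerHofstad2017, Cor. 1.3 (d = 11), EJP p. 6] -/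
theorem meanField_full_d11_typedStage1_discharged
    (hI43 : NobleAssumption43At 11 (nbwThresholdI 11)
      (percolationNobleSplit 11 (nbwThresholdI 11) two_le_eleven (nbwThresholdI_lt_criticalProbI two_le_eleven))
      (inpMajQ dataHi P stateRec .i SQr SbQr))
    (hIW : NobleWeightedDiagramBoundAt 11 (nbwThresholdI 11) bi)
    (hS : ∀ (p : unitInterval) (hp : p ∈ Set.Ioo (nbwThresholdI 11) (criticalProbI 11)),
      (∀ j, Literature.Barriers.CriticalPhenomena.nobleF 11 cMuC cWeightsC j p ≤ GammaC j) →
        NobleAssumption43At 11 p (percolationNobleSplit 11 p two_le_eleven hp.2) (inpMajQ dataHi P stateRec .o SQr SbQr) ∧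
        NobleWeightedDiagramBoundAt 11 p bo) :
    MeanField 11 :=
  meanField_of_triangle (by norm_num) (meanField_d11_typedStage1_discharged hI43 hIW hS).1

end D11

end Literature.Probability.FitznerVanDerHofstad2017

end
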